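import Literature.NumberTheory.Sieve.PolymathGEHTupleLevelStatic
import HarnessLib

/-!
# The level of distribution of the truncated inner sequence: summing the pieces (fixed `x`)

Trunk AntSieve, tooling toward the named fact `Literature.NumberTheory.Sieve.weakDHL_three_two_of_GEH`
(D. H. J. Polymath, Res. Math. Sci. 1:12 (2014) = arXiv:1407.4897, Theorem 3.2(xii)).

§4.5, p. 17, bound (local), at a fixed large `x`: the discrepancy sum of the windowed truncated sequence
is bounded by the discrepancy sums `S_τ` of the convolution majorants of the RELEVANT tuples (those
are what `GEH`/`EH` control) plus `ℓ¹` error terms: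

* `sum_iSup_le_of_majorant` — the per-piece inequality summed over `q ≤ Q`;
* `sum_iSup_winSeq_le_sum_pieces` — `Σ_q sup_a |Δ(winSeq)| ≤ Σ_{s<R₀} Σ_τ Σ_q sup_a |Δ(u_τ)|`;
* `pieceSeq_eq_zero_of_not_rel` — irrelevant tuples (box away from the window) contribute nothing;
* `sum_l1_le`, `sum_l1_le_card` — the `ℓ¹` norms of the majorants summed over tuples, via the
  DISJOINTNESS `Σ_τ Conv_τ ≤ s+1` (`sum_tupleConv_le`): `≤ (s+1) T` in general and `≤ (s+1) #E` when
  the supports lie in an exceptional set `E`;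
* `exceptional_of_bad` — for a relevant tuple that is not good, the support of `Conv_τ` consists of
  integers with two close prime factors (`E₁`) or within a factor `ρ''` of `X₁` or `X₂` (`E₂`);
* `card_closePrimes_le`, `card_near_le` — `#E₁ ≤ (J+1)(ρ'-1)² T`, `#E₂ ≤ 2(ρ''-1) X + 1`.

## References

* [Polymath8b2014] D. H. J. Polymath, Res. Math. Sci. 1 (2014), Art. 12 = arXiv:1407.4897,
  §4.5, p. 17.
-/

noncomputable section

open Finset Real
open scoped ArithmeticFunction.omega

namespace Literature.NumberTheory.Sieve

open scoped Classical

/-! ### The per-piece inequality summed over the moduli -/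

/-- The majorant bound summed over `q ≤ Q`. [cite: Polymath8b2014, §4.5, p. 17] -/
theorem sum_iSup_le_of_majorant {u Conv : ℕ → ℝ} {c' H : ℝ} (hH : 0 ≤ H)
    (hmaj : ∀ n, |u n - c' * Conv n| ≤ H * Conv n) (hConv0 : ∀ n, 0 ≤ Conv n)
    {X₂ N : ℕ} (hu : ∀ n, X₂ < n → u n = 0) (hC : ∀ n, N < n → Conv n = 0) (Q : ℕ) :
    ∑ q ∈ Icc 1 Q, (⨆ a : (ZMod q)ˣ, |apDiscrepancy u X₂ q a|) ≤
      (|c'| + H) * ∑ q ∈ Icc 1 Q, (⨆ a : (ZMod q)ˣ, |apDiscrepancy Conv N q a|) +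
        2 * H * (∑ n ∈ Icc 1 N, Conv n) * ∑ q ∈ Icc 1 Q, (1 : ℝ) / Nat.totient q := by
  rw [Finset.mul_sum, Finset.mul_sum, ← Finset.sum_add_distrib]
  refine Finset.sum_le_sum fun q hq => ?_
  have hq1 : 1 ≤ q := (Finset.mem_Icc.1 hq).1
  have h := iSup_abs_apDiscrepancy_le_of_majorant hH hmaj hConv0 hu hC hq1
  calc _ ≤ _ := h
    _ = _ := by ring

/-- `Σ_{1 ≤ r ≤ R} f r = Σ_{s < R} f (s+1)`. [folklore] -/
theorem sum_Icc_one_eq_sum_range (f : ℕ → ℝ) (R : ℕ) :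
    ∑ r ∈ Icc 1 R, f r = ∑ s ∈ Finset.range R, f (s + 1) := by
  induction R with
  | zero => simp
  | succ R ih => rw [Finset.sum_Icc_succ_top (by omega), ih, Finset.sum_range_succ]

section Fixed

variable {F G : ℝ → ℝ} {M D ε A₀ x : ℝ} {h₀ : ℤ}

/-- **Decomposition of the discrepancy sum**:
`Σ_q sup_a |Δ(winSeq; X₂)| ≤ Σ_{s < R₀} Σ_{τ ∈ monoTuples (s+1) J} Σ_q sup_a |Δ(u_τ; X₂)|`. [cite: Polymath8b2014, §4.5, p. 17] -/
theorem sum_iSup_winSeq_le_sum_pieces (hMF : ∀ t, |F t| ≤ M) (hMG : ∀ t, |G t| ≤ M) (hε : 0 < ε)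
    (hx4 : 4 ≤ x) (hxε : 3 ≤ x ^ ε) (hxh : (h₀.natAbs : ℝ) + 2 ≤ x) (Q : ℕ) :
    ∑ q ∈ Icc 1 Q, (⨆ a : (ZMod q)ˣ, |apDiscrepancy (winSeq F G ε h₀ x) (thetaX2 h₀ x) q a|) ≤
      ∑ s ∈ Finset.range (⌊1 / ε⌋₊ + 1), ∑ τ ∈ monoTuples (s + 1) (gridJ A₀ x),
        ∑ q ∈ Icc 1 Q, (⨆ a : (ZMod q)ˣ, |apDiscrepancy (pieceSeq F G ε A₀ h₀ x τ) (thetaX2 h₀ x) q a|) := by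
  set R₀ := ⌊1 / ε⌋₊ + 1
  set J := gridJ A₀ x
  set X₂ := thetaX2 h₀ x
  have hdec : winSeq F G ε h₀ x = fun n => ∑ r ∈ Icc 1 R₀, ∑ τ ∈ monoTuples r J, pieceSeq F G ε A₀ h₀ x τ n :=
    funext fun n => winSeq_eq_sum_pieceSeq hMF hMG hε hx4 hxε hxh n
  -- reindex the right-hand side by `r = s + 1` and swap the sums
  rw [← sum_Icc_one_eq_sum_range (fun r => ∑ τ ∈ monoTuples r J,
    ∑ q ∈ Icc 1 Q, (⨆ a : (ZMod q)ˣ, |apDiscrepancy (pieceSeq F G ε A₀ h₀ x τ) X₂ q a|)) R₀]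
  simp_rw [Finset.sum_comm (s := monoTuples _ J) (t := Icc 1 Q)]
  rw [Finset.sum_comm]
  refine Finset.sum_le_sum fun q hq => ?_
  have hq1 : 1 ≤ q := (Finset.mem_Icc.1 hq).1
  haveI : NeZero q := ⟨by omega⟩
  refine ciSup_le fun a => ?_
  rw [hdec, apDiscrepancy_sum]
  refine (Finset.abs_sum_le_sum_abs _ _).trans (Finset.sum_le_sum fun r _ => ?_)
  rw [apDiscrepancy_sum]
  refine (Finset.abs_sum_le_sum_abs _ _).trans (Finset.sum_le_sum fun τ _ => ?_)
  exact le_ciSup (f := fun a : (ZMod q)ˣ => |apDiscrepancy (pieceSeq F G ε A₀ h₀ x τ) X₂ q a|)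
    ((Set.finite_range _).bddAbove) a

/-- **Irrelevant tuples contribute nothing**: if the box `(∏ c_{τ i}, ∏ c_{τ i+1}]` misses the window
then `u_τ ≡ 0`. [folklore] -/
theorem pieceSeq_eq_zero_of_not_rel (hMF : ∀ t, |F t| ≤ M) (hMG : ∀ t, |G t| ≤ M) (hε : 0 < ε)
    (hx4 : 4 ≤ x) (hxε : 3 ≤ x ^ ε) (hxh : (h₀.natAbs : ℝ) + 2 ≤ x) {s : ℕ} {τ : Fin (s + 1) → ℕ}
    (hnot : ¬ (boxBot ε A₀ x τ < thetaX2 h₀ x ∧ thetaX1 h₀ x < boxTop ε A₀ x τ)) (n : ℕ) :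
    pieceSeq F G ε A₀ h₀ x τ n = 0 := by
  by_contra hne
  obtain ⟨-, hmem, h1, h2, -⟩ := mem_of_pieceSeq_ne_zero hMF hMG hε hx4 hxε hxh hne
  have hlo := prod_lt_of_mem_tupleProducts (c := gridAt ε A₀ x) (by omega) hmem
  have hhi := le_prod_of_mem_tupleProducts (c := gridAt ε A₀ x) hmem
  exact hnot ⟨lt_of_lt_of_le hlo h2, lt_of_lt_of_le h1 hhi⟩

/-- **Per-piece bound, every tuple** (`c' = 0`, `H = 4^{R₀} M²`). [cite: Polymath8b2014, §4.5, p. 17] -/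
theorem sum_iSup_pieceSeq_le (hMF : ∀ t, |F t| ≤ M) (hMG : ∀ t, |G t| ≤ M) (hε : 0 < ε)
    (hx4 : 4 ≤ x) (hxε : 3 ≤ x ^ ε) (hxh : (h₀.natAbs : ℝ) + 2 ≤ x) {s : ℕ} (τ : Fin (s + 1) → ℕ) (Q : ℕ) :
    ∑ q ∈ Icc 1 Q, (⨆ a : (ZMod q)ˣ, |apDiscrepancy (pieceSeq F G ε A₀ h₀ x τ) (thetaX2 h₀ x) q a|) ≤
      (4 ^ (⌊1 / ε⌋₊ + 1) * M ^ 2) *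
          ∑ q ∈ Icc 1 Q, (⨆ a : (ZMod q)ˣ, |apDiscrepancy (tupleConv (gridAt ε A₀ x) τ) (boxTop ε A₀ x τ) q a|) +
        2 * (4 ^ (⌊1 / ε⌋₊ + 1) * M ^ 2) * (∑ n ∈ Icc 1 (boxTop ε A₀ x τ), tupleConv (gridAt ε A₀ x) τ n) *
          ∑ q ∈ Icc 1 Q, (1 : ℝ) / Nat.totient q := by
  have h := sum_iSup_le_of_majorant (u := pieceSeq F G ε A₀ h₀ x τ) (Conv := fun n => tupleConv (gridAt ε A₀ x) τ n)
    (c' := 0) (H := 4 ^ (⌊1 / ε⌋₊ + 1) * M ^ 2) (by positivity)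
    (fun n => by rw [zero_mul, sub_zero]; exact abs_pieceSeq_le hMF hMG hε hx4 hxε hxh τ n)
    (fun n => tupleConv_nonneg _ τ n) (X₂ := thetaX2 h₀ x) (N := boxTop ε A₀ x τ)
    (fun n hn => pieceSeq_eq_zero_of_lt τ hn)
    (fun n hn => tupleConv_eq_zero_of_lt (gridAt ε A₀ x) τ hn) Q
  rwa [abs_zero, zero_add] at h

/-- **Per-piece bound, good tuple** (`c' = c_τ`, `H = η_s`). [cite: Polymath8b2014, §4.5, p. 17] -/
theorem sum_iSup_pieceSeq_le_good (hFd : Differentiable ℝ F) (hGd : Differentiable ℝ G)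
    (hMF : ∀ t, |F t| ≤ M) (hMG : ∀ t, |G t| ≤ M) (hDF : ∀ t, |deriv F t| ≤ D) (hDG : ∀ t, |deriv G t| ≤ D)
    (hε : 0 < ε) (hx4 : 4 ≤ x) (hxε : 3 ≤ x ^ ε) (hxh : (h₀.natAbs : ℝ) + 2 ≤ x)
    {s : ℕ} {τ : Fin (s + 1) → ℕ} (hτJ : ∀ i, τ i ≤ gridJ A₀ x) (hgood : IsGoodTuple ε A₀ h₀ x τ) (Q : ℕ) :
    ∑ q ∈ Icc 1 Q, (⨆ a : (ZMod q)ˣ, |apDiscrepancy (pieceSeq F G ε A₀ h₀ x τ) (thetaX2 h₀ x) q a|) ≤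
      (|tupleModel F G ε A₀ x τ| +
          2 * 4 ^ (s + 1) * M * D * (s + 1) * ((gridRho A₀ x * (1 + 2 / x ^ ε) - 1) / Real.log x)) *
          ∑ q ∈ Icc 1 Q, (⨆ a : (ZMod q)ˣ, |apDiscrepancy (tupleConv (gridAt ε A₀ x) τ) (boxTop ε A₀ x τ) q a|) +
        2 * (2 * 4 ^ (s + 1) * M * D * (s + 1) * ((gridRho A₀ x * (1 + 2 / x ^ ε) - 1) / Real.log x)) *
          (∑ n ∈ Icc 1 (boxTop ε A₀ x τ), tupleConv (gridAt ε A₀ x) τ n) *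
          ∑ q ∈ Icc 1 Q, (1 : ℝ) / Nat.totient q := by
  have hx0 : 0 < x := by linarith
  have hM0 : 0 ≤ M := (abs_nonneg _).trans (hMF 0)
  have hD0 : 0 ≤ D := (abs_nonneg _).trans (hDF 0)
  have hlog : 0 < Real.log x := Real.log_pos (by linarith)
  have hρ'1 : 0 ≤ gridRho A₀ x * (1 + 2 / x ^ ε) - 1 := by
    have h1 := (one_lt_gridRho A₀ x).le
    have h2 : (1 : ℝ) ≤ 1 + 2 / x ^ ε := by
      have := div_nonneg (by norm_num : (0 : ℝ) ≤ 2) (Real.rpow_nonneg hx0.le ε); linarith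
    nlinarith
  have hη0 : 0 ≤ 2 * 4 ^ (s + 1) * M * D * (s + 1) * ((gridRho A₀ x * (1 + 2 / x ^ ε) - 1) / Real.log x) := by
    positivity
  exact sum_iSup_le_of_majorant (u := pieceSeq F G ε A₀ h₀ x τ) (Conv := fun n => tupleConv (gridAt ε A₀ x) τ n)
    hη0 (fun n => abs_pieceSeq_sub_model_le hFd hGd hMF hMG hDF hDG hε hx4 hxε hxh hτJ hgood n)
    (fun n => tupleConv_nonneg _ τ n) (X₂ := thetaX2 h₀ x) (N := boxTop ε A₀ x τ)
    (fun n hn => pieceSeq_eq_zero_of_lt τ hn)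
    (fun n hn => tupleConv_eq_zero_of_lt (gridAt ε A₀ x) τ hn) Q

/-- `|c_τ| ≤ 4^{s+1} M²`. [folklore] -/
theorem abs_tupleModel_le (hMF : ∀ t, |F t| ≤ M) (hMG : ∀ t, |G t| ≤ M) {s : ℕ} (τ : Fin (s + 1) → ℕ) :
    |tupleModel F G ε A₀ x τ| ≤ 4 ^ (s + 1) * M ^ 2 := by
  have hM0 : 0 ≤ M := (abs_nonneg _).trans (hMF 0)
  rw [tupleModel, abs_mul]
  calc |modelValue F (gridLog ε A₀ x) τ| * |modelValue G (gridLog ε A₀ x) τ|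
      ≤ (2 ^ (s + 1) * M) * (2 ^ (s + 1) * M) :=
        mul_le_mul (abs_modelValue_le hMF _ τ) (abs_modelValue_le hMG _ τ) (abs_nonneg _) (by positivity)
    _ = 4 ^ (s + 1) * M ^ 2 := by
        rw [show (4 : ℝ) ^ (s + 1) = 2 ^ (s + 1) * 2 ^ (s + 1) by rw [← mul_pow]; norm_num]; ring

end Fixed

/-! ### The `ℓ¹` sums over tuples -/

section L1

variable {c : ℕ → ℕ}

/-- **`ℓ¹` norms over tuples with tops `≤ T`**: `Σ_τ Σ_{n ≤ top τ} Conv_τ(n) ≤ (s+1) T`. [cite: Polymath8b2014, §4.5, p. 17] -/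
theorem sum_l1_le (hc : Monotone c) (s J T : ℕ) (S : Finset (Fin (s + 1) → ℕ)) (hS : S ⊆ monoTuples (s + 1) J)
    (hT : ∀ τ ∈ S, ∏ i, c (τ i + 1) ≤ T) :
    ∑ τ ∈ S, ∑ n ∈ Icc 1 (∏ i, c (τ i + 1)), tupleConv c τ n ≤ (s + 1) * T := by
  calc ∑ τ ∈ S, ∑ n ∈ Icc 1 (∏ i, c (τ i + 1)), tupleConv c τ n
      ≤ ∑ τ ∈ S, ∑ n ∈ Icc 1 T, tupleConv c τ n := by
        refine Finset.sum_le_sum fun τ hτ => Finset.sum_le_sum_of_subset_of_nonneg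
          (Finset.Icc_subset_Icc_right (hT τ hτ)) fun n _ _ => tupleConv_nonneg c τ n
    _ ≤ ∑ τ ∈ monoTuples (s + 1) J, ∑ n ∈ Icc 1 T, tupleConv c τ n :=
        Finset.sum_le_sum_of_subset_of_nonneg hS fun τ _ _ => Finset.sum_nonneg fun n _ => tupleConv_nonneg c τ n
    _ = ∑ n ∈ Icc 1 T, ∑ τ ∈ monoTuples (s + 1) J, tupleConv c τ n := Finset.sum_comm
    _ ≤ ∑ n ∈ Icc 1 T, ((s : ℝ) + 1) := Finset.sum_le_sum fun n _ => sum_tupleConv_le hc s J n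
    _ = (s + 1) * T := by rw [Finset.sum_const, Nat.card_Icc, nsmul_eq_mul]; push_cast; ring

/-- **`ℓ¹` norms over tuples whose supports lie in `E`**: `≤ (s+1) #E`. [cite: Polymath8b2014, §4.5, p. 17] -/
theorem sum_l1_le_card (hc : Monotone c) (s J : ℕ) (S : Finset (Fin (s + 1) → ℕ)) (hS : S ⊆ monoTuples (s + 1) J)
    (E : Finset ℕ) (hE : ∀ τ ∈ S, ∀ n, 0 < tupleConv c τ n → n ∈ E) :
    ∑ τ ∈ S, ∑ n ∈ Icc 1 (∏ i, c (τ i + 1)), tupleConv c τ n ≤ (s + 1) * E.card := by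
  calc ∑ τ ∈ S, ∑ n ∈ Icc 1 (∏ i, c (τ i + 1)), tupleConv c τ n
      ≤ ∑ τ ∈ S, ∑ n ∈ E, tupleConv c τ n := by
        refine Finset.sum_le_sum fun τ hτ => ?_
        rw [← Finset.sum_filter_of_ne (p := fun n => n ∈ E) (fun n _ hne =>
          hE τ hτ n (lt_of_le_of_ne (tupleConv_nonneg c τ n) (Ne.symm hne)))]
        exact Finset.sum_le_sum_of_subset_of_nonneg (fun n hn => (Finset.mem_filter.1 hn).2)
          fun n _ _ => tupleConv_nonneg c τ n
    _ ≤ ∑ τ ∈ monoTuples (s + 1) J, ∑ n ∈ E, tupleConv c τ n :=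
        Finset.sum_le_sum_of_subset_of_nonneg hS fun τ _ _ => Finset.sum_nonneg fun n _ => tupleConv_nonneg c τ n
    _ = ∑ n ∈ E, ∑ τ ∈ monoTuples (s + 1) J, tupleConv c τ n := Finset.sum_comm
    _ ≤ ∑ n ∈ E, ((s : ℝ) + 1) := Finset.sum_le_sum fun n _ => sum_tupleConv_le hc s J n
    _ = (s + 1) * E.card := by rw [Finset.sum_const, nsmul_eq_mul]; ring

end L1

/-! ### The exceptional integers -/

section Exceptional

variable {F G : ℝ → ℝ} {M D ε A₀ x : ℝ} {h₀ : ℤ}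

/-- `top τ ≤ ρ'^{s+1} bot τ`. [folklore] -/
theorem boxTop_le_pow_mul_boxBot (hx : 0 < x) (hxε : 3 ≤ x ^ ε) {r : ℕ} (τ : Fin r → ℕ) :
    (boxTop ε A₀ x τ : ℝ) ≤ (gridRho A₀ x * (1 + 2 / x ^ ε)) ^ r * boxBot ε A₀ x τ := by
  unfold boxTop boxBot
  push_cast
  have h : (gridRho A₀ x * (1 + 2 / x ^ ε)) ^ r * ∏ i, (gridAt ε A₀ x (τ i) : ℝ) =
      ∏ i : Fin r, ((gridRho A₀ x * (1 + 2 / x ^ ε)) * (gridAt ε A₀ x (τ i) : ℝ)) := by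
    rw [Finset.prod_mul_distrib, Finset.prod_const, Finset.card_univ, Fintype.card_fin]
  rw [h]
  exact Finset.prod_le_prod (fun i _ => Nat.cast_nonneg _) fun i _ => gridAt_succ_le_ratio hx hxε (τ i)

/-- **Relevant but not good**: the support of `Conv_τ` is exceptional.  For `τ` monotone with entries
`≤ J`, relevant (`bot < X₂`, `X₁ < top`) and not good, every `n` with `Conv_τ(n) > 0` either has two
prime factors `c_j < p ≤ p' ≤ c_{j+1}` in one piece, or lies in `(X₁/ρ'', ρ'' X₁)` or in
`(X₂/ρ'', ρ'' X₂)`, `ρ'' = ρ'^{s+1}`; and `n ≤ ρ'' X₂`. [cite: Polymath8b2014, §4.5, p. 17] -/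
theorem exceptional_of_bad (hx4 : 4 ≤ x) (hxε : 3 ≤ x ^ ε) {s : ℕ} {τ : Fin (s + 1) → ℕ}
    (hτm : Monotone τ) (hτJ : ∀ i, τ i ≤ gridJ A₀ x)
    (hrel : boxBot ε A₀ x τ < thetaX2 h₀ x ∧ thetaX1 h₀ x < boxTop ε A₀ x τ)
    (hbad : ¬ IsGoodTuple ε A₀ h₀ x τ) {n : ℕ} (hpos : 0 < tupleConv (gridAt ε A₀ x) τ n) :
    ((∃ j p p', j ≤ gridJ A₀ x ∧ p.Prime ∧ p'.Prime ∧ gridAt ε A₀ x j < p ∧ p ≤ p' ∧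
        p' ≤ gridAt ε A₀ x (j + 1) ∧ p * p' ∣ n) ∨
      ((thetaX1 h₀ x : ℝ) / (gridRho A₀ x * (1 + 2 / x ^ ε)) ^ (s + 1) < n ∧
        (n : ℝ) < (gridRho A₀ x * (1 + 2 / x ^ ε)) ^ (s + 1) * thetaX1 h₀ x) ∨
      ((thetaX2 h₀ x : ℝ) / (gridRho A₀ x * (1 + 2 / x ^ ε)) ^ (s + 1) < n ∧
        (n : ℝ) < (gridRho A₀ x * (1 + 2 / x ^ ε)) ^ (s + 1) * thetaX2 h₀ x)) ∧
      (n : ℝ) ≤ (gridRho A₀ x * (1 + 2 / x ^ ε)) ^ (s + 1) * thetaX2 h₀ x := by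
  have hx0 : 0 < x := by linarith
  set c := gridAt ε A₀ x with hcdef
  have hc : Monotone c := gridAt_mono ε A₀ x
  set ρ'' : ℝ := (gridRho A₀ x * (1 + 2 / x ^ ε)) ^ (s + 1) with hρ''
  have hρ'1 : 1 ≤ gridRho A₀ x * (1 + 2 / x ^ ε) := by
    have h1 := (one_lt_gridRho A₀ x).le
    have h2 : (1 : ℝ) ≤ 1 + 2 / x ^ ε := by
      have := div_nonneg (by norm_num : (0 : ℝ) ≤ 2) (Real.rpow_nonneg hx0.le ε); linarith
    nlinarith
  have hρ''1 : 1 ≤ ρ'' := one_le_pow₀ hρ'1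
  have hρ''0 : 0 < ρ'' := by linarith
  have hmem := mem_tupleProducts_of_tupleConv_pos c τ hpos
  have hlo := prod_lt_of_mem_tupleProducts (c := c) (by omega) hmem
  have hhi := le_prod_of_mem_tupleProducts (c := c) hmem
  have htb : (boxTop ε A₀ x τ : ℝ) ≤ ρ'' * boxBot ε A₀ x τ := boxTop_le_pow_mul_boxBot hx0 hxε τ
  have hbot_eq : (boxBot ε A₀ x τ : ℝ) = ((∏ i, c (τ i) : ℕ) : ℝ) := rfl
  have htop_eq : (boxTop ε A₀ x τ : ℝ) = ((∏ i, c (τ i + 1) : ℕ) : ℝ) := rfl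
  have hlo' : ((∏ i, c (τ i) : ℕ) : ℝ) < n := by exact_mod_cast hlo
  have hhi' : (n : ℝ) ≤ ((∏ i, c (τ i + 1) : ℕ) : ℝ) := by exact_mod_cast hhi
  rw [← hbot_eq] at hlo'
  rw [← htop_eq] at hhi'
  have hrel1 : (boxBot ε A₀ x τ : ℝ) < thetaX2 h₀ x := by exact_mod_cast hrel.1
  have hrel2 : (thetaX1 h₀ x : ℝ) < boxTop ε A₀ x τ := by exact_mod_cast hrel.2
  have hnle : (n : ℝ) ≤ ρ'' * thetaX2 h₀ x := hhi'.trans (htb.trans (by nlinarith))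
  refine ⟨?_, hnle⟩
  -- which clause of goodness fails?
  by_cases hsm : StrictMono τ
  · right
    have hbad' : ¬ (thetaX1 h₀ x ≤ boxBot ε A₀ x τ ∧ boxTop ε A₀ x τ ≤ thetaX2 h₀ x) := fun h => hbad ⟨hsm, h⟩
    rcases not_and_or.1 hbad' with h1 | h2
    · left
      push Not at h1
      have h1' : (boxBot ε A₀ x τ : ℝ) < thetaX1 h₀ x := by exact_mod_cast h1
      constructor
      · rw [div_lt_iff₀ hρ''0]
        nlinarith
      · nlinarith
    · right
      push Not at h2
      have h2' : (thetaX2 h₀ x : ℝ) < boxTop ε A₀ x τ := by exact_mod_cast h2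
      constructor
      · rw [div_lt_iff₀ hρ''0]
        nlinarith
      · nlinarith
  · left
    have hidx := idxList_eq_of_tupleConv_pos hc hτm hτJ hpos
    exact exists_close_primes_of_not_strictMono hc hτm hsm (primeFactors_of_mem_tupleProducts hc hτJ hmem) hidx

/-- **Integers with two close prime factors**: if `c_{j+1} ≤ ρ' c_j` for `j ≤ J` then
`#{n ≤ T : ∃ j ≤ J, ∃ primes c_j < p ≤ p' ≤ c_{j+1}, p p' ∣ n} ≤ (J+1) (ρ'-1)² T`. [cite: Polymath8b2014, §4.5, p. 17] -/
theorem card_closePrimes_le (c : ℕ → ℕ) (J T : ℕ) {ρ' : ℝ} (hρ' : 1 ≤ ρ') (hc1 : ∀ j, 1 ≤ c j)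
    (hratio : ∀ j ≤ J, (c (j + 1) : ℝ) ≤ ρ' * c j) :
    (((Icc 1 T).filter fun n => ∃ j p p', j ≤ J ∧ p.Prime ∧ p'.Prime ∧ c j < p ∧ p ≤ p' ∧
        p' ≤ c (j + 1) ∧ p * p' ∣ n).card : ℝ) ≤ (J + 1) * (ρ' - 1) ^ 2 * T := by
  set S := (Icc 1 T).filter fun n => ∃ j p p', j ≤ J ∧ p.Prime ∧ p'.Prime ∧ c j < p ∧ p ≤ p' ∧
    p' ≤ c (j + 1) ∧ p * p' ∣ n with hS
  have hcover : S ⊆ (Finset.range (J + 1)).biUnion fun j => (gridPiece c j ×ˢ gridPiece c j).biUnion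
      fun pp => (Icc 1 T).filter (fun n => pp.1 * pp.2 ∣ n) := by
    intro n hn
    rw [hS, Finset.mem_filter] at hn
    obtain ⟨hnT, j, p, p', hj, hp, hp', h1, h2, h3, hdvd⟩ := hn
    rw [Finset.mem_biUnion]
    refine ⟨j, Finset.mem_range.2 (by omega), ?_⟩
    rw [Finset.mem_biUnion]
    refine ⟨(p, p'), Finset.mem_product.2 ⟨(mem_gridPiece c).2 ⟨h1, h2.trans h3, hp⟩,
      (mem_gridPiece c).2 ⟨by omega, h3, hp'⟩⟩, ?_⟩
    exact Finset.mem_filter.2 ⟨hnT, hdvd⟩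
  calc (S.card : ℝ) ≤ ∑ j ∈ Finset.range (J + 1), ∑ pp ∈ gridPiece c j ×ˢ gridPiece c j,
        (((Icc 1 T).filter (fun n => pp.1 * pp.2 ∣ n)).card : ℝ) := by
        have h1 := Finset.card_le_card hcover
        have h2 := Finset.card_biUnion_le (s := Finset.range (J + 1)) (t := fun j =>
          (gridPiece c j ×ˢ gridPiece c j).biUnion fun pp => (Icc 1 T).filter (fun n => pp.1 * pp.2 ∣ n))
        have h3 : ∀ j ∈ Finset.range (J + 1), ((gridPiece c j ×ˢ gridPiece c j).biUnion fun pp =>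
            (Icc 1 T).filter (fun n => pp.1 * pp.2 ∣ n)).card ≤
            ∑ pp ∈ gridPiece c j ×ˢ gridPiece c j, ((Icc 1 T).filter (fun n => pp.1 * pp.2 ∣ n)).card :=
          fun j _ => Finset.card_biUnion_le
        exact_mod_cast h1.trans (h2.trans (Finset.sum_le_sum h3))
    _ ≤ ∑ j ∈ Finset.range (J + 1), ∑ pp ∈ gridPiece c j ×ˢ gridPiece c j, (T : ℝ) / (c j : ℝ) ^ 2 := by
        refine Finset.sum_le_sum fun j _ => Finset.sum_le_sum fun pp hpp => ?_
        obtain ⟨hp, hp'⟩ := Finset.mem_product.1 hpp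
        obtain ⟨h1, -, hpp1⟩ := (mem_gridPiece c).1 hp
        obtain ⟨h1', -, hpp2⟩ := (mem_gridPiece c).1 hp'
        have hcard : ((Icc 1 T).filter (fun n => pp.1 * pp.2 ∣ n)).card = T / (pp.1 * pp.2) := by
          rw [show Icc 1 T = Ioc 0 T from rfl]; exact Nat.Ioc_filter_dvd_card_eq_div _ _
        rw [hcard]
        have hcj : (0 : ℝ) < c j := by exact_mod_cast hc1 j
        have hprod : ((c j : ℝ)) ^ 2 ≤ ((pp.1 * pp.2 : ℕ) : ℝ) := by
          push_cast
          rw [sq]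
          exact mul_le_mul (by exact_mod_cast h1.le) (by exact_mod_cast h1'.le) hcj.le (Nat.cast_nonneg _)
        calc ((T / (pp.1 * pp.2) : ℕ) : ℝ) ≤ (T : ℝ) / ((pp.1 * pp.2 : ℕ) : ℝ) := Nat.cast_div_le
          _ ≤ (T : ℝ) / (c j : ℝ) ^ 2 := div_le_div_of_nonneg_left (Nat.cast_nonneg _) (by positivity) hprod
    _ ≤ ∑ j ∈ Finset.range (J + 1), (ρ' - 1) ^ 2 * T := by
        refine Finset.sum_le_sum fun j hj => ?_
        rw [Finset.sum_const, nsmul_eq_mul, Finset.card_product]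
        have hjJ : j ≤ J := by have := Finset.mem_range.1 hj; omega
        have hcj : (0 : ℝ) < c j := by exact_mod_cast hc1 j
        -- `#piece_j ≤ c_{j+1} - c_j ≤ (ρ' - 1) c_j`
        have hpc : ((gridPiece c j).card : ℝ) ≤ (ρ' - 1) * c j := by
          have h1 : (gridPiece c j).card ≤ c (j + 1) - c j :=
            (Finset.card_filter_le _ _).trans (by rw [Nat.card_Ioc])
          have h2 : (((c (j + 1) - c j : ℕ)) : ℝ) ≤ (ρ' - 1) * c j := by
            rcases le_or_gt (c j) (c (j + 1)) with h | h
            · rw [Nat.cast_sub h]; have := hratio j hjJ; linarith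
            · rw [Nat.sub_eq_zero_of_le h.le, Nat.cast_zero]; exact mul_nonneg (by linarith) hcj.le
          exact le_trans (by exact_mod_cast h1) h2
        have hpc0 : (0 : ℝ) ≤ (gridPiece c j).card := Nat.cast_nonneg _
        calc (((gridPiece c j).card * (gridPiece c j).card : ℕ) : ℝ) * ((T : ℝ) / (c j : ℝ) ^ 2)
            = ((gridPiece c j).card : ℝ) ^ 2 * T / (c j : ℝ) ^ 2 := by push_cast; ring
          _ ≤ ((ρ' - 1) * c j) ^ 2 * T / (c j : ℝ) ^ 2 := by
              gcongr
          _ = (ρ' - 1) ^ 2 * T := by field_simp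
    _ = (J + 1) * (ρ' - 1) ^ 2 * T := by
        rw [Finset.sum_const, Finset.card_range, nsmul_eq_mul]; push_cast; ring

/-- **Integers near `X`**: `#{n ≥ 1 : X/ρ'' < n < ρ'' X} ≤ 2 (ρ'' - 1) X + 1` (`ρ'' ≥ 1`, `X ≥ 0`). [folklore] -/
theorem card_near_le (T : ℕ) {X ρ'' : ℝ} (hX : 0 ≤ X) (hρ : 1 ≤ ρ'') :
    (((Icc 1 T).filter fun n : ℕ => X / ρ'' < n ∧ (n : ℝ) < ρ'' * X).card : ℝ) ≤ 2 * (ρ'' - 1) * X + 1 := by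
  have hρ0 : 0 < ρ'' := by linarith
  set a := ⌊X / ρ''⌋₊
  set b := ⌊ρ'' * X⌋₊
  have hsub : ((Icc 1 T).filter fun n : ℕ => X / ρ'' < n ∧ (n : ℝ) < ρ'' * X) ⊆ Ioc a b := by
    intro n hn
    rw [Finset.mem_filter] at hn
    rw [Finset.mem_Ioc]
    exact ⟨(Nat.floor_lt (by positivity)).2 hn.2.1, Nat.le_floor hn.2.2.le⟩
  have h1 := Finset.card_le_card hsub
  rw [Nat.card_Ioc] at h1
  have h2 : ((b - a : ℕ) : ℝ) ≤ 2 * (ρ'' - 1) * X + 1 := by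
    rcases le_or_gt a b with hab | hab
    · rw [Nat.cast_sub hab]
      have hb : (b : ℝ) ≤ ρ'' * X := Nat.floor_le (by positivity)
      have ha : X / ρ'' - 1 < a := by have := Nat.lt_floor_add_one (X / ρ''); linarith
      -- `ρ'' X - X/ρ'' ≤ 2 (ρ'' - 1) X` since `ρ'' + 1/ρ'' ≥ 2`
      have hkey : ρ'' * X - X / ρ'' ≤ 2 * (ρ'' - 1) * X := by
        rw [show ρ'' * X - X / ρ'' = (ρ'' - 1 / ρ'') * X by ring]
        refine mul_le_mul_of_nonneg_right ?_ hX
        have : 1 / ρ'' ≥ 2 - ρ'' := by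
          rw [ge_iff_le, le_div_iff₀ hρ0]; nlinarith
        linarith
      linarith
    · rw [Nat.sub_eq_zero_of_le hab.le, Nat.cast_zero]
      have : 0 ≤ 2 * (ρ'' - 1) * X := by nlinarith
      linarith
  exact le_trans (by exact_mod_cast h1) h2

end Exceptional

/-! ### The total at a fixed `x` -/

section Total

variable {F G : ℝ → ℝ} {M D ε A₀ x : ℝ} {h₀ : ℤ}

/-- The relevant tuples: box meeting the window. [cite: Polymath8b2014, §4.5, p. 17] -/
def relTuples (ε A₀ : ℝ) (h₀ : ℤ) (x : ℝ) (s : ℕ) : Finset (Fin (s + 1) → ℕ) :=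
  (monoTuples (s + 1) (gridJ A₀ x)).filter fun τ =>
    boxBot ε A₀ x τ < thetaX2 h₀ x ∧ thetaX1 h₀ x < boxTop ε A₀ x τ

/-- The exceptional integers of order `s` at `x`: two close prime factors in one piece, or within a
factor `ρ'' = ρ'^{s+1}` of `X₁` or of `X₂`; all `≤ ρ'' X₂`. [cite: Polymath8b2014, §4.5, p. 17] -/
def excSet (ε A₀ : ℝ) (h₀ : ℤ) (x : ℝ) (s : ℕ) : Finset ℕ :=
  (Icc 1 ⌊(gridRho A₀ x * (1 + 2 / x ^ ε)) ^ (s + 1) * thetaX2 h₀ x⌋₊).filter fun n =>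
    (∃ j p p', j ≤ gridJ A₀ x ∧ p.Prime ∧ p'.Prime ∧ gridAt ε A₀ x j < p ∧ p ≤ p' ∧
        p' ≤ gridAt ε A₀ x (j + 1) ∧ p * p' ∣ n) ∨
      ((thetaX1 h₀ x : ℝ) / (gridRho A₀ x * (1 + 2 / x ^ ε)) ^ (s + 1) < n ∧
        (n : ℝ) < (gridRho A₀ x * (1 + 2 / x ^ ε)) ^ (s + 1) * thetaX1 h₀ x) ∨
      ((thetaX2 h₀ x : ℝ) / (gridRho A₀ x * (1 + 2 / x ^ ε)) ^ (s + 1) < n ∧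
        (n : ℝ) < (gridRho A₀ x * (1 + 2 / x ^ ε)) ^ (s + 1) * thetaX2 h₀ x)

/-- The relevant tuples are monotone tuples with entries `≤ J`. [folklore] -/
theorem relTuples_subset (s : ℕ) : relTuples ε A₀ h₀ x s ⊆ monoTuples (s + 1) (gridJ A₀ x) :=
  Finset.filter_subset _ _

/-- **The total of order `s` at a fixed large `x`.**  With `Cw = 4^{R₀} M²`,
`η_s = 2·4^{s+1} M D (s+1)(ρ'-1)/log x`, `Φ = Σ_{q ≤ Q} 1/φ(q)`:
`Σ_{τ ∈ monoTuples (s+1) J} Σ_q sup_a |Δ(u_τ; X₂)| ≤ (Cw + η_s) Σ_{τ relevant} S_τ + 2Φ (η_s (s+1) X₂ + Cw (s+1) #E_s)`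
where `S_τ = Σ_q sup_a |Δ(Conv_τ; top τ)|`. [cite: Polymath8b2014, §4.5, p. 17] -/
theorem sum_pieces_le_total (hFd : Differentiable ℝ F) (hGd : Differentiable ℝ G)
    (hMF : ∀ t, |F t| ≤ M) (hMG : ∀ t, |G t| ≤ M) (hDF : ∀ t, |deriv F t| ≤ D) (hDG : ∀ t, |deriv G t| ≤ D)
    (hε : 0 < ε) (hx4 : 4 ≤ x) (hxε : 3 ≤ x ^ ε) (hxh : (h₀.natAbs : ℝ) + 2 ≤ x)
    {s : ℕ} (hs : s + 1 ≤ ⌊1 / ε⌋₊ + 1) (Q : ℕ) :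
    ∑ τ ∈ monoTuples (s + 1) (gridJ A₀ x),
        ∑ q ∈ Icc 1 Q, (⨆ a : (ZMod q)ˣ, |apDiscrepancy (pieceSeq F G ε A₀ h₀ x τ) (thetaX2 h₀ x) q a|) ≤
      (4 ^ (⌊1 / ε⌋₊ + 1) * M ^ 2 +
          2 * 4 ^ (s + 1) * M * D * (s + 1) * ((gridRho A₀ x * (1 + 2 / x ^ ε) - 1) / Real.log x)) *
          ∑ τ ∈ relTuples ε A₀ h₀ x s, ∑ q ∈ Icc 1 Q,
            (⨆ a : (ZMod q)ˣ, |apDiscrepancy (tupleConv (gridAt ε A₀ x) τ) (boxTop ε A₀ x τ) q a|) +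
        2 * (∑ q ∈ Icc 1 Q, (1 : ℝ) / Nat.totient q) *
          (2 * 4 ^ (s + 1) * M * D * (s + 1) * ((gridRho A₀ x * (1 + 2 / x ^ ε) - 1) / Real.log x) *
              ((s + 1) * thetaX2 h₀ x) +
            4 ^ (⌊1 / ε⌋₊ + 1) * M ^ 2 * ((s + 1) * (excSet ε A₀ h₀ x s).card)) := by
  have hx0 : 0 < x := by linarith
  have hM0 : 0 ≤ M := (abs_nonneg _).trans (hMF 0)
  have hD0 : 0 ≤ D := (abs_nonneg _).trans (hDF 0)
  have hlog : 0 < Real.log x := Real.log_pos (by linarith)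
  set c := gridAt ε A₀ x with hcdef
  have hc : Monotone c := gridAt_mono ε A₀ x
  set J := gridJ A₀ x
  set X₁ := thetaX1 h₀ x
  set X₂ := thetaX2 h₀ x
  set Cw : ℝ := 4 ^ (⌊1 / ε⌋₊ + 1) * M ^ 2 with hCw
  set ρ' : ℝ := gridRho A₀ x * (1 + 2 / x ^ ε) with hρ'
  set η : ℝ := 2 * 4 ^ (s + 1) * M * D * (s + 1) * ((ρ' - 1) / Real.log x) with hη
  set Φ : ℝ := ∑ q ∈ Icc 1 Q, (1 : ℝ) / Nat.totient q with hΦ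
  set P : (Fin (s + 1) → ℕ) → ℝ := fun τ =>
    ∑ q ∈ Icc 1 Q, (⨆ a : (ZMod q)ˣ, |apDiscrepancy (pieceSeq F G ε A₀ h₀ x τ) X₂ q a|) with hP
  set S : (Fin (s + 1) → ℕ) → ℝ := fun τ =>
    ∑ q ∈ Icc 1 Q, (⨆ a : (ZMod q)ˣ, |apDiscrepancy (tupleConv c τ) (boxTop ε A₀ x τ) q a|) with hSdef
  set L : (Fin (s + 1) → ℕ) → ℝ := fun τ => ∑ n ∈ Icc 1 (boxTop ε A₀ x τ), tupleConv c τ n with hL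
  have hρ'1 : 1 ≤ ρ' := by
    have h1 := (one_lt_gridRho A₀ x).le
    have h2 : (1 : ℝ) ≤ 1 + 2 / x ^ ε := by
      have := div_nonneg (by norm_num : (0 : ℝ) ≤ 2) (Real.rpow_nonneg hx0.le ε); linarith
    rw [hρ']; nlinarith
  have hη0 : 0 ≤ η := by rw [hη]; exact mul_nonneg (by positivity) (div_nonneg (by linarith) hlog.le)
  have hCw0 : 0 ≤ Cw := by positivity
  have hΦ0 : 0 ≤ Φ := Finset.sum_nonneg fun q _ => by positivity
  have hS0 : ∀ τ, 0 ≤ S τ := fun τ => Finset.sum_nonneg fun q _ => Real.iSup_nonneg fun _ => abs_nonneg _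
  have hL0 : ∀ τ, 0 ≤ L τ := fun τ => Finset.sum_nonneg fun n _ => tupleConv_nonneg c τ n
  have hP0 : ∀ τ, 0 ≤ P τ := fun τ => Finset.sum_nonneg fun q _ => Real.iSup_nonneg fun _ => abs_nonneg _
  -- `4^{s+1} M² ≤ Cw`
  have h4s : (4 : ℝ) ^ (s + 1) * M ^ 2 ≤ Cw := by
    rw [hCw]; exact mul_le_mul_of_nonneg_right (pow_le_pow_right₀ (by norm_num) hs) (sq_nonneg M)
  -- irrelevant tuples contribute `0`
  set Rel := relTuples ε A₀ h₀ x s with hRel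
  have hsplit : ∑ τ ∈ monoTuples (s + 1) J, P τ = ∑ τ ∈ Rel, P τ := by
    rw [hRel, relTuples, Finset.sum_filter]
    refine Finset.sum_congr rfl fun τ _ => ?_
    split_ifs with hrel
    · rfl
    · rw [hP]
      refine Finset.sum_eq_zero fun q hq => ?_
      have hq1 : 1 ≤ q := (Finset.mem_Icc.1 hq).1
      haveI : NeZero q := ⟨by omega⟩
      have hzero : pieceSeq F G ε A₀ h₀ x τ = fun _ => 0 :=
        funext fun n => pieceSeq_eq_zero_of_not_rel hMF hMG hε hx4 hxε hxh hrel n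
      simp only [hzero, apDiscrepancy_zero, abs_zero, ciSup_const]
  -- per-piece bounds on the relevant tuples
  have hgood : ∀ τ ∈ Rel, IsGoodTuple ε A₀ h₀ x τ → P τ ≤ (Cw + η) * S τ + 2 * Φ * (η * L τ) := by
    intro τ hτ hg
    have hτJ : ∀ i, τ i ≤ J := (mem_monoTuples.1 (relTuples_subset s hτ)).1
    have h := sum_iSup_pieceSeq_le_good hFd hGd hMF hMG hDF hDG hε hx4 hxε hxh hτJ hg Q
    have hc' : |tupleModel F G ε A₀ x τ| ≤ Cw := (abs_tupleModel_le hMF hMG τ).trans h4s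
    calc P τ ≤ (|tupleModel F G ε A₀ x τ| + η) * S τ + 2 * η * L τ * Φ := h
      _ ≤ (Cw + η) * S τ + 2 * Φ * (η * L τ) := by
          have := hS0 τ
          nlinarith
  have hbad : ∀ τ ∈ Rel, P τ ≤ (Cw + η) * S τ + 2 * Φ * (Cw * L τ) := by
    intro τ _
    have h := sum_iSup_pieceSeq_le hMF hMG hε hx4 hxε hxh τ Q (A₀ := A₀)
    calc P τ ≤ Cw * S τ + 2 * Cw * L τ * Φ := h
      _ ≤ (Cw + η) * S τ + 2 * Φ * (Cw * L τ) := by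
          have := hS0 τ
          nlinarith
  -- split the relevant tuples into good and bad
  have hsum : ∑ τ ∈ Rel, P τ ≤ (Cw + η) * ∑ τ ∈ Rel, S τ +
      2 * Φ * (η * ∑ τ ∈ Rel.filter (fun τ => IsGoodTuple ε A₀ h₀ x τ), L τ +
        Cw * ∑ τ ∈ Rel.filter (fun τ => ¬ IsGoodTuple ε A₀ h₀ x τ), L τ) := by
    have hP' : ∀ τ ∈ Rel, P τ ≤ (Cw + η) * S τ + 2 * Φ *
        ((if IsGoodTuple ε A₀ h₀ x τ then η * L τ else 0) + (if ¬ IsGoodTuple ε A₀ h₀ x τ then Cw * L τ else 0)) := by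
      intro τ hτ
      by_cases hg : IsGoodTuple ε A₀ h₀ x τ
      · rw [if_pos hg, if_neg (not_not.2 hg), add_zero]; exact hgood τ hτ hg
      · rw [if_neg hg, if_pos hg, zero_add]; exact hbad τ hτ
    calc ∑ τ ∈ Rel, P τ ≤ ∑ τ ∈ Rel, ((Cw + η) * S τ + 2 * Φ *
          ((if IsGoodTuple ε A₀ h₀ x τ then η * L τ else 0) +
            (if ¬ IsGoodTuple ε A₀ h₀ x τ then Cw * L τ else 0))) := Finset.sum_le_sum hP'
      _ = _ := by
          rw [Finset.sum_add_distrib, ← Finset.mul_sum, ← Finset.mul_sum, Finset.sum_add_distrib,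
            Finset.sum_ite, Finset.sum_ite, Finset.sum_const_zero, Finset.sum_const_zero, add_zero, add_zero,
            ← Finset.mul_sum, ← Finset.mul_sum]
  -- the `ℓ¹` sums
  have hLgood : ∑ τ ∈ Rel.filter (fun τ => IsGoodTuple ε A₀ h₀ x τ), L τ ≤ (s + 1) * X₂ := by
    refine sum_l1_le hc s J X₂ _ ((Finset.filter_subset _ _).trans (relTuples_subset s)) fun τ hτ => ?_
    exact (Finset.mem_filter.1 hτ).2.2.2
  have hLbad : ∑ τ ∈ Rel.filter (fun τ => ¬ IsGoodTuple ε A₀ h₀ x τ), L τ ≤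
      (s + 1) * (excSet ε A₀ h₀ x s).card := by
    refine sum_l1_le_card hc s J _ ((Finset.filter_subset _ _).trans (relTuples_subset s)) _ fun τ hτ n hn => ?_
    obtain ⟨hτR, hb⟩ := Finset.mem_filter.1 hτ
    obtain ⟨hτJ, hτm⟩ := mem_monoTuples.1 (relTuples_subset s hτR)
    have hrel := (Finset.mem_filter.1 hτR).2
    obtain ⟨hE, hnle⟩ := exceptional_of_bad hx4 hxε hτm hτJ hrel hb hn
    have hn0 : n ≠ 0 := by
      rintro rfl
      rw [ArithmeticFunction.map_zero] at hn
      exact lt_irrefl _ hn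
    rw [excSet, Finset.mem_filter, Finset.mem_Icc]
    exact ⟨⟨Nat.one_le_iff_ne_zero.2 hn0, Nat.le_floor hnle⟩, hE⟩
  -- assemble
  have hX₂0 : (0 : ℝ) ≤ X₂ := Nat.cast_nonneg _
  calc ∑ τ ∈ monoTuples (s + 1) J, P τ = ∑ τ ∈ Rel, P τ := hsplit
    _ ≤ _ := hsum
    _ ≤ (Cw + η) * ∑ τ ∈ Rel, S τ + 2 * Φ * (η * ((s + 1) * X₂) + Cw * ((s + 1) * (excSet ε A₀ h₀ x s).card)) := by
        gcongr

end Total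

end Literature.NumberTheory.Sieve
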